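import Summits.AnomalousDissipation.AnomalousDissipation.Theorems.CubicParityLoud.Negative.Clauses
import Literature.Analysis.FluidPDE.NSHopfLimit
import Literature.Analysis.FunctionSpaces.TorusTrigPoly
import HarnessLib

/-!
# Stub S11 `stub_lowModePassage` for line `enstrophy-ui-transfer` of crux
# `MomentParity.ResolvedDissipation` (stmt-AnomalousDissipation-14284)

Supports stmt-AnomalousDissipation-14284 (stub stub_lowModePassage for line enstrophy-ui-transfer,
lead c7). Nothing here closes an item.

**The low-mode enstrophy integrals pass to the limit.** If the fields `U n τ` (`τ ∈ [s, t]`) have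
`∫‖U n τ‖² ≤ B`, Fourier coefficients measurable in time on `(s, t)`, and converge coefficientwise
at every time of `[s, t]` to `u τ`, then for every cutoff `K`
`∫ₛᵗ ‖∇P_K U n τ‖² dτ → ∫ₛᵗ ‖∇P_K u τ‖² dτ` (in `ℝ≥0∞`).

Proof: `‖∇P_K v‖² = 4π² Σ_{|k|² ≤ K²} |k|² ‖v̂(k)‖²` is a FINITE band sum of squares of Fourier
coefficients (`eGradNormSq_fourierTruncate_band`, valid for every field: non-integrable fields have
vanishing Bochner coefficients, `mFourierCoeff_complexify_eq_zero_of_not_integrable`), hence the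
integrands converge at every time (finitely many coefficients converge), are measurable in time,
and are dominated by the constant `4π²K²B` (`|k|² ≤ K²` on the ball and Bessel,
`Torus.integral_norm_sq_fourierTruncate(_le)`), which is integrable on the finite interval;
dominated convergence for `lintegral` (`tendsto_lintegral_of_dominated_convergence'`).
-/

noncomputable section

-- `Summit.<Summit>.<Problem>`: single-conjunct summit, the duplicate namespace segment is mandated.
set_option linter.dupNamespace false

namespace Summit.AnomalousDissipation.AnomalousDissipation.Theorems.MomentParityResolvedDissipation.LowModePassage

open MeasureTheory Filter Topology Set UnitAddTorus
open scoped ENNReal InnerProductSpace RealInnerProductSpace BigOperators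
open Literature.Analysis.FunctionSpaces Literature.Analysis.FunctionSpaces.Torus
open Literature.Analysis.FluidPDE Literature.Analysis.FluidPDE.Torus
open Summit.AnomalousDissipation.AnomalousDissipation.Theorems.CubicParityLoud.Negative (T3 R3)

/-- **Bochner junk for Fourier coefficients**: the Fourier coefficients of the complexification of a
NON-integrable real field on `T³` all vanish (the Fourier integrand `e_{-k} • (complexify ∘ v)` is
integrable iff `v` is, `‖e_{-k}‖ = 1`). [folklore] -/
theorem mFourierCoeff_complexify_eq_zero_of_not_integrable {v : T3 → R3}
    (hv : ¬ Integrable v volume) (k : Fin 3 → ℤ) :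
    mFourierCoeff (EuclideanSpace.complexify ∘ v) k = 0 := by
  have hc : ¬ Integrable (EuclideanSpace.complexify ∘ v) volume := by
    intro h
    apply hv
    have h' := ContinuousLinearMap.integrable_comp (EuclideanSpace.realPart (ι := Fin 3)) h
    simpa [Function.comp_def, EuclideanSpace.realPart_complexify] using h'
  rw [mFourierCoeff_eq_integral_volume]
  apply integral_undef
  intro hg
  apply hc
  refine (integrable_mFourier_smul' hg (-k)).congr (Eventually.of_forall fun x => ?_)
  simp only [Function.comp_apply]
  rw [smul_smul, ← mFourier_add, neg_neg, add_neg_cancel, mFourier_zero, ContinuousMap.one_apply,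
    one_smul]

/-- **Conjugate symmetry of the Fourier coefficients of a complexified real field on `T³`, with no
integrability hypothesis**: for integrable `v` this is `Torus.isConjSymm_mFourierCoeff`; for
non-integrable `v` all coefficients vanish. [folklore] -/
theorem isConjSymm_mFourierCoeff_all (v : T3 → R3) :
    IsConjSymm (fun k => mFourierCoeff (EuclideanSpace.complexify ∘ v) k) := by
  by_cases hv : Integrable v volume
  · exact isConjSymm_mFourierCoeff hv
  · intro k
    simp only [mFourierCoeff_complexify_eq_zero_of_not_integrable hv, EuclideanSpace.conjVec_zero]

/-- **The truncated enstrophy is a finite band sum, for every field**: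
`‖∇P_K v‖² = 4π² Σ_{|k|² ≤ K²} |k|² ‖v̂(k)‖²` in `ℝ≥0∞` (`Torus.eGradNormSq_realTrigPoly` on the
symmetric frequency ball with the conjugate-symmetric coefficient family of `v`). [folklore] -/
theorem eGradNormSq_fourierTruncate_band (K : ℕ) (v : T3 → R3) :
    Torus.eGradNormSq (Torus.fourierTruncate K v) =
      ENNReal.ofReal (4 * Real.pi ^ 2 * ∑ k ∈ freqBall K,
        freqNormSq k * ‖mFourierCoeff (EuclideanSpace.complexify ∘ v) k‖ ^ 2) := by
  rw [fourierTruncate_eq]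
  exact eGradNormSq_realTrigPoly neg_mem_freqBall_of_mem (isConjSymm_mFourierCoeff_all v)

/-- **Bernstein and Bessel for the band sum**: for `v ∈ L²(T³)` with `∫‖v‖² ≤ B`,
`4π² Σ_{|k|² ≤ K²} |k|² ‖v̂(k)‖² ≤ 4π²K²B` (`|k|² ≤ K²` on the ball, `Torus.mem_freqBall`;
`Σ_{|k|² ≤ K²} ‖v̂(k)‖² = ∫‖P_K v‖² ≤ ∫‖v‖²`, `Torus.integral_norm_sq_fourierTruncate(_le)`). [folklore] -/
theorem lowMode_band_le (K : ℕ) {v : T3 → R3} {B : ℝ} (hv : MemLp v 2 volume)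
    (hB : ∫ x, ‖v x‖ ^ 2 ≤ B) :
    4 * Real.pi ^ 2 * ∑ k ∈ freqBall K,
        freqNormSq k * ‖mFourierCoeff (EuclideanSpace.complexify ∘ v) k‖ ^ 2 ≤
      4 * Real.pi ^ 2 * (K : ℝ) ^ 2 * B := by
  have hint : Integrable v volume := hv.integrable one_le_two
  have h1 : ∑ k ∈ freqBall K, freqNormSq k * ‖mFourierCoeff (EuclideanSpace.complexify ∘ v) k‖ ^ 2 ≤
      (K : ℝ) ^ 2 * ∑ k ∈ freqBall K, ‖mFourierCoeff (EuclideanSpace.complexify ∘ v) k‖ ^ 2 := by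
    rw [Finset.mul_sum]
    exact Finset.sum_le_sum fun k hk => mul_le_mul_of_nonneg_right (mem_freqBall.1 hk) (sq_nonneg _)
  have h2 : ∑ k ∈ freqBall K, ‖mFourierCoeff (EuclideanSpace.complexify ∘ v) k‖ ^ 2 ≤ B := by
    rw [← integral_norm_sq_fourierTruncate hint K]
    exact (integral_norm_sq_fourierTruncate_le hv K).trans hB
  have hpi : 0 ≤ 4 * Real.pi ^ 2 := by positivity
  calc 4 * Real.pi ^ 2 * ∑ k ∈ freqBall K,
        freqNormSq k * ‖mFourierCoeff (EuclideanSpace.complexify ∘ v) k‖ ^ 2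
      ≤ 4 * Real.pi ^ 2 * ((K : ℝ) ^ 2 * B) := by
        refine mul_le_mul_of_nonneg_left (h1.trans ?_) hpi
        exact mul_le_mul_of_nonneg_left h2 (sq_nonneg _)
    _ = 4 * Real.pi ^ 2 * (K : ℝ) ^ 2 * B := by ring

/-- **S11 · `stub_lowModePassage` — the low-mode enstrophy integrals pass to the limit.** If the
fields `U n τ` (`τ ∈ [s, t]`, `0 ≤ s ≤ t`) have `∫‖U n τ‖² ≤ B`, measurable Fourier coefficients in
time, and converge coefficientwise at every time of `[s, t]` to `u τ`, then for every cutoff `K`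
`∫ₛᵗ ‖∇P_K U n‖² → ∫ₛᵗ ‖∇P_K u‖²`: `‖∇P_K v‖² = 4π² Σ_{|k|≤K} |k|²‖v̂ k‖²` is a FINITE sum of
squares of Fourier coefficients (`eGradNormSq_fourierTruncate_band`), each converging at every time
by hypothesis, measurable in time, and dominated by the constant `4π²K²B` (`lowMode_band_le`),
integrable on the finite interval; dominated convergence for `lintegral`
(`tendsto_lintegral_of_dominated_convergence'`). [folklore] -/
theorem stub_lowModePassage (K : ℕ) (U : ℕ → ℝ → T3 → R3) (u : ℝ → T3 → R3) (s t : ℝ) (hs : 0 ≤ s)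
    (hst : s ≤ t) (B : ℝ)
    (hU2 : ∀ n τ, s ≤ τ → τ ≤ t → MemLp (U n τ) 2 volume)
    (hB : ∀ n τ, s ≤ τ → τ ≤ t → ∫ x, ‖U n τ x‖ ^ 2 ≤ B)
    (hmeas : ∀ n k, AEStronglyMeasurable
      (fun τ => UnitAddTorus.mFourierCoeff (EuclideanSpace.complexify ∘ U n τ) k) (volume.restrict (Set.Ioo s t)))
    (hcv : ∀ τ, s ≤ τ → τ ≤ t → ∀ k, Filter.Tendsto
      (fun n => UnitAddTorus.mFourierCoeff (EuclideanSpace.complexify ∘ U n τ) k) Filter.atTop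
      (𝓝 (UnitAddTorus.mFourierCoeff (EuclideanSpace.complexify ∘ u τ) k))) :
    Filter.Tendsto (fun n => ∫⁻ τ in Set.Ioo s t, Torus.eGradNormSq (Torus.fourierTruncate K (U n τ)))
      Filter.atTop (𝓝 (∫⁻ τ in Set.Ioo s t, Torus.eGradNormSq (Torus.fourierTruncate K (u τ)))) := by
  -- `0 ≤ s ≤ t` (the window lies in positive time) are part of the registered signature; the
  -- argument below is local in `τ ∈ (s, t)` and only records them.
  have _hwindow : 0 ≤ t := hs.trans hst
  simp only [eGradNormSq_fourierTruncate_band]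
  refine tendsto_lintegral_of_dominated_convergence'
    (fun _ => ENNReal.ofReal (4 * Real.pi ^ 2 * (K : ℝ) ^ 2 * B)) (fun n => ?_) (fun n => ?_) ?_ ?_
  · -- measurability in time of the band sums
    have h : AEMeasurable (fun τ => 4 * Real.pi ^ 2 * ∑ k ∈ freqBall K,
        freqNormSq k * ‖mFourierCoeff (EuclideanSpace.complexify ∘ U n τ) k‖ ^ 2)
        (volume.restrict (Ioo s t)) := by
      refine AEMeasurable.const_mul (Finset.aemeasurable_fun_sum (freqBall K) fun k _ => ?_) _
      exact ((hmeas n k).norm.aemeasurable.pow_const 2).const_mul _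
    exact ENNReal.measurable_ofReal.comp_aemeasurable h
  · -- domination by the constant `4π²K²B`
    filter_upwards [ae_restrict_mem measurableSet_Ioo] with τ hτ
    exact ENNReal.ofReal_le_ofReal
      (lowMode_band_le K (hU2 n τ hτ.1.le hτ.2.le) (hB n τ hτ.1.le hτ.2.le))
  · -- the constant is integrable on the finite interval
    rw [setLIntegral_const, Real.volume_Ioo]
    exact ENNReal.mul_ne_top ENNReal.ofReal_ne_top ENNReal.ofReal_ne_top
  · -- pointwise convergence at every time of `(s, t)`
    filter_upwards [ae_restrict_mem measurableSet_Ioo] with τ hτ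
    refine ENNReal.tendsto_ofReal (Tendsto.const_mul _ (tendsto_finsetSum _ fun k _ => ?_))
    exact Tendsto.const_mul _ (((hcv τ hτ.1.le hτ.2.le k).norm).pow 2)

end Summit.AnomalousDissipation.AnomalousDissipation.Theorems.MomentParityResolvedDissipation.LowModePassage
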